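/-
Copyright (c) 2026 the pub-hodgecm-mathlib formalisation cell (harness21).  Prover seat hodgecm-mathlib-K2Liu-p05 (g4), 2026-09-04
(Track B «K2-LIT», crux hLiu418 = stmt-HodgeConjecture-24832, LEAD F0P6-plan (g13) RULING M-157i′ organ (SD-1), part (L2):
POLARISATION — every monomial × Gaussian is an explicit finite combination of line derivatives of shifted Gaussians).
-/
import Summits.HodgeConjecture.HodgeConjecture.Theorems.K2LiuPolyGaussianShiftDerivatives   -- (SD-1) L1: `iteratedDeriv_bkerCore_smul_zero`
import Mathlib.Data.Nat.Choose.Sum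
import Mathlib.Algebra.BigOperators.Ring.Finset
import HarnessLib

/-!
# (SD-1, L2) Polarisation `d!·y₁⋯y_d = Σ_{S ⊆ [d]} (−1)^{d−|S|} (Σ_{j∈S} y_j)^d` and the coefficient table for monomial × Gaussian vectors

Track B ∕ K2-LIT, hLiu418 = stmt-HodgeConjecture-24832; LEAD F0P6-plan (g13) RULING M-157i′ (SD-1) + 09:09:12Z «(SD-1) = p05's (L1)+(L2) GO».  Namespace
`Summit.HodgeConjecture.HodgeConjecture.Cruxes.HLiu418.K2LiuPolyGaussianShiftDerivatives` (continued).  THEOREMS ONLY (no definition, no instance, no notation,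
no named fact, no `sorry`); `--supports stmt-HodgeConjecture-24832 --as helper`.

* §1 **`factorial_mul_prod_eq_sum_powerset_pow`** — THE POLARISATION IDENTITY in any commutative ring: for `y : Fin d → R`,
  `d! · ∏_j y_j = Σ_{S : Finset (Fin d)} (−1)^{d − #S} · (Σ_{j ∈ S} y_j)^d` (expand `(Σ_{j∈S} y_j)^d` over words `p : Fin d → S` (Mathlib `Finset.sum_pow'`),
  swap the sums, and for a word `p` with image `T` the signed count `Σ_{S ⊇ T} (−1)^{d−#S}` is `[T = univ]` by inclusion–exclusion (Mathlib
  `Finset.sum_powerset_neg_one_pow_card`); the surviving words are the permutations, each contributing `∏_j y_j`, and there are `d!` of them);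
* §2 **`factorial_smul_hermiteFun_prod_X`** — THE COEFFICIENT TABLE: for letters `i : Fin d → σ` (a monomial of degree `d` written with repetitions),
  `d! · (2π)^d · (∏_j x_{i j}) e^{−π|x|²} = Σ_{S ⊆ [d]} (−1)^{d−#S} · (d∕dt)^d|_{t=0} bkerCore (t • 𝟙^i_S) x`, where `𝟙^i_S : σ → ℂ`, `k ↦ #{j ∈ S | i j = k}` is the
  multiplicity vector of the sub-word `S` (a REAL, indeed integral, direction) — by §1 in `ℂ[x_σ]` and (L1) ★ `iteratedDeriv_bkerCore_smul_zero`
  (`(d∕dt)^d|₀ bkerCore (t • ξ) x = hermiteFun ((2π Σ ξ_k X_k)^d) x`); hence `hermiteFun (C c * ∏_j X (i j))` and, by linearity (★ `hermiteFun_add∕_smul`), every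
  polynomial × Gaussian vector is an explicit finite `ℚ(π)`-combination of `d`-th line derivatives at `0` of shifted Gaussians along integral directions —
  the letter (SD-2) consumes with one-variable Cauchy estimates.

HONEST LABEL: HC_CM is proved only modulo the 7 printed citations (2 remaining named inputs: hLiu418 = stmt-HodgeConjecture-24832, h413 =
stmt-HodgeConjecture-24833) until rung 0 closes; organ capital, moves no counter.

## References
[Howe1989] R. Howe, *Transcending classical invariant theory*, J. Amer. Math. Soc. 2 (1989), §3 · [Folland1989] G. B. Folland, *Harmonic Analysis in Phase Space*
(1989), §1.6–§1.7 · polarisation of monomials: standard (e.g. [Varadarajan1984] V. S. Varadarajan, *Lie Groups, Lie Algebras, and Their Representations*, proof of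
Thm. 3.15.2, or any account of the symmetric tensor ∕ homogeneous polynomial dictionary).
-/

set_option autoImplicit false
set_option linter.dupNamespace false

noncomputable section

open Complex MvPolynomial Finset
open scoped Real
open Literature.Analysis.SegalBargmann

namespace Summit.HodgeConjecture.HodgeConjecture.Cruxes.HLiu418.K2LiuPolyGaussianShiftDerivatives

/-! ## §1 Polarisation in a commutative ring -/

section Polarisation

variable {R : Type*} [CommRing R] {d : ℕ}

/-- inclusion–exclusion: for `T ⊆ [d]`, `Σ_{S ⊇ T} (−1)^{d − #S} = [T = univ]`. [folklore] -/
theorem sum_neg_one_pow_card_sdiff_filter_superset (T : Finset (Fin d)) :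
    (∑ S ∈ (univ : Finset (Finset (Fin d))).filter (fun S => T ⊆ S), (-1 : R) ^ (d - #S)) = if T = univ then 1 else 0 := by
  classical
  -- reparametrise `S = T ∪ U`, `U ⊆ Tᶜ`
  have hbij : ∑ S ∈ (univ : Finset (Finset (Fin d))).filter (fun S => T ⊆ S), (-1 : R) ^ (d - #S) =
      ∑ U ∈ (Tᶜ).powerset, (-1 : R) ^ (d - #(T ∪ U)) := by
    refine Finset.sum_nbij' (fun S => S \ T) (fun U => T ∪ U) ?_ ?_ ?_ ?_ ?_
    · intro S hS
      rw [mem_powerset]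
      intro j hj
      rw [mem_compl]
      exact (mem_sdiff.1 hj).2
    · intro U hU
      rw [mem_filter]
      exact ⟨mem_univ _, subset_union_left⟩
    · intro S hS
      rw [mem_filter] at hS
      exact union_sdiff_of_subset hS.2
    · intro U hU
      rw [mem_powerset] at hU
      ext j
      simp only [mem_sdiff, mem_union]
      constructor
      · rintro ⟨h | h, h'⟩
        · exact (h' h).elim
        · exact h
      · intro h
        exact ⟨Or.inr h, fun hT => (mem_compl.1 (hU h)) hT⟩
    · intro S hS
      rw [mem_filter] at hS
      rw [union_sdiff_of_subset hS.2]
  rw [hbij]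
  -- `d − #(T ∪ U) = #Tᶜ − #U` and the sign
  have hcard : ∀ U ∈ (Tᶜ).powerset, (-1 : R) ^ (d - #(T ∪ U)) = (-1) ^ #Tᶜ * (-1) ^ #U := by
    intro U hU
    rw [mem_powerset] at hU
    have hdisj : Disjoint T U := disjoint_left.2 fun j hjT hjU => (mem_compl.1 (hU hjU)) hjT
    have hUle : #U ≤ #Tᶜ := card_le_card hU
    have h1 : d - #(T ∪ U) = #Tᶜ - #U := by
      rw [card_union_of_disjoint hdisj, card_compl, Fintype.card_fin]
      omega
    rw [h1]
    have h2 : (-1 : R) ^ #Tᶜ = (-1) ^ (#Tᶜ - #U) * (-1) ^ #U := by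
      rw [← pow_add, Nat.sub_add_cancel hUle]
    rw [h2, mul_assoc, ← pow_add, ← two_mul, pow_mul, neg_one_sq, one_pow, mul_one]
  rw [Finset.sum_congr rfl hcard, ← Finset.mul_sum]
  by_cases hT : T = univ
  · subst hT
    rw [if_pos rfl, compl_univ, Finset.powerset_empty, Finset.sum_singleton, card_empty, pow_zero, mul_one]
  · rw [if_neg hT]
    have hne : (Tᶜ).Nonempty := nonempty_iff_ne_empty.2 fun h => hT ((compl_eq_empty_iff _).1 h)
    have hz := congrArg (Int.cast (R := R)) (Finset.sum_powerset_neg_one_pow_card_of_nonempty hne)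
    push_cast at hz
    rw [hz, mul_zero]

/-- **POLARISATION**: `d! · ∏_{j < d} y_j = Σ_{S ⊆ [d]} (−1)^{d − #S} · (Σ_{j ∈ S} y_j)^d` in any commutative ring. [folklore] -/
theorem factorial_mul_prod_eq_sum_powerset_pow (y : Fin d → R) :
    ((d.factorial : ℕ) : R) * ∏ j, y j = ∑ S : Finset (Fin d), (-1 : R) ^ (d - #S) * (∑ j ∈ S, y j) ^ d := by
  classical
  -- expand the powers over words `p : Fin d → Fin d` with letters in `S`
  have hexp : ∀ S : Finset (Fin d), (∑ j ∈ S, y j) ^ d = ∑ p : Fin d → Fin d, if ∀ k, p k ∈ S then ∏ k, y (p k) else 0 := by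
    intro S
    rw [Finset.sum_pow', ← Finset.sum_filter]
    refine Finset.sum_congr ?_ fun p _ => rfl
    ext p
    simp only [Fintype.mem_piFinset, mem_filter, mem_univ, true_and]
  simp_rw [hexp, Finset.mul_sum]
  rw [Finset.sum_comm]
  -- for each word, the signed count of the supersets of its image
  have hword : ∀ p : Fin d → Fin d, (∑ S : Finset (Fin d), (-1 : R) ^ (d - #S) * if ∀ k, p k ∈ S then ∏ k, y (p k) else 0) =
      if Function.Bijective p then ∏ j, y j else 0 := by
    intro p
    have h1 : (∑ S : Finset (Fin d), (-1 : R) ^ (d - #S) * if ∀ k, p k ∈ S then ∏ k, y (p k) else 0) =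
        (∑ S ∈ (univ : Finset (Finset (Fin d))).filter (fun S => univ.image p ⊆ S), (-1 : R) ^ (d - #S)) * ∏ k, y (p k) := by
      rw [Finset.sum_mul, Finset.sum_filter]
      refine Finset.sum_congr rfl fun S _ => ?_
      have hiff : univ.image p ⊆ S ↔ ∀ k, p k ∈ S := by
        rw [image_subset_iff]
        exact ⟨fun h k => h k (mem_univ k), fun h k _ => h k⟩
      by_cases hp : ∀ k, p k ∈ S
      · rw [if_pos hp, if_pos (hiff.2 hp)]
      · rw [if_neg hp, if_neg (fun h => hp (hiff.1 h)), mul_zero]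
    rw [h1, sum_neg_one_pow_card_sdiff_filter_superset]
    have hiff : univ.image p = univ ↔ Function.Bijective p := by
      constructor
      · intro h
        refine Finite.surjective_iff_bijective.1 fun j => ?_
        have hj : j ∈ univ.image p := by rw [h]; exact mem_univ j
        obtain ⟨k, -, hk⟩ := mem_image.1 hj
        exact ⟨k, hk⟩
      · intro h
        exact Finset.image_univ_of_surjective h.2
    by_cases hp : Function.Bijective p
    · rw [if_pos (hiff.2 hp), if_pos hp, one_mul]
      exact (Equiv.ofBijective p hp).prod_comp y
    · rw [if_neg (fun h => hp (hiff.1 h)), if_neg hp, zero_mul]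
  simp_rw [hword]
  -- the surviving words are the `d!` permutations
  rw [← Finset.sum_filter]
  have hperm : (∑ p ∈ (univ : Finset (Fin d → Fin d)).filter Function.Bijective, ∏ j, y j) =
      ∑ e : Equiv.Perm (Fin d), ∏ j, y j := by
    refine Finset.sum_nbij' (fun p => if hp : Function.Bijective p then Equiv.ofBijective p hp else 1) (fun e => ⇑e) ?_ ?_ ?_ ?_ ?_
    · intro p _; exact mem_univ _
    · intro e _; exact mem_filter.2 ⟨mem_univ _, e.bijective⟩
    · intro p hp
      rw [mem_filter] at hp
      simp only [dif_pos hp.2]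
      rfl
    · intro e _
      simp only [dif_pos e.bijective]
      exact Equiv.ext fun j => rfl
    · intro p _; rfl
  rw [hperm, Finset.sum_const, Finset.card_univ, Fintype.card_perm, Fintype.card_fin, nsmul_eq_mul]

end Polarisation

/-! ## §2 The coefficient table: monomial × Gaussian vectors from line derivatives of shifted Gaussians -/

section Table

variable {σ : Type*} [Fintype σ] [DecidableEq σ]

/-- the linear form of the multiplicity vector of a sub-word, numerically: `Σ_k #{j ∈ S | i j = k} · x_k = Σ_{j ∈ S} x_{i j}`. [folklore] -/
theorem sum_card_filter_mul {d : ℕ} (i : Fin d → σ) (S : Finset (Fin d)) (x : σ → ℝ) :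
    (∑ k, ((#(S.filter fun j => i j = k) : ℕ) : ℂ) * (x k : ℂ)) = ∑ j ∈ S, (x (i j) : ℂ) := by
  rw [← Finset.sum_fiberwise' S i fun k => (x k : ℂ)]
  refine Finset.sum_congr rfl fun k _ => ?_
  rw [Finset.sum_const, nsmul_eq_mul]

/-- **the line derivative along the multiplicity vector of a sub-word**: `(d∕dt)^d|₀ bkerCore (t • 𝟙^i_S) x = (2π)^d (Σ_{j∈S} x_{i j})^d e^{−π|x|²}`
((L1) ★ `iteratedDeriv_bkerCore_smul_zero` read numerically). [cite: Folland1989, §1.6] -/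
theorem iteratedDeriv_bkerCore_smul_indicator_zero {d : ℕ} (i : Fin d → σ) (S : Finset (Fin d)) (x : σ → ℝ) :
    iteratedDeriv d (fun t : ℂ => bkerCore (t • fun k => ((#(S.filter fun j => i j = k) : ℕ) : ℂ)) x) 0 =
      (2 * π : ℂ) ^ d * (∑ j ∈ S, (x (i j) : ℂ)) ^ d * gauss x := by
  rw [iteratedDeriv_bkerCore_smul_zero, hermiteFun]
  simp only [map_pow, map_mul, map_sum, eval_C, eval_X]
  rw [sum_card_filter_mul, mul_pow]

/-- **THE COEFFICIENT TABLE.**  For letters `i : Fin d → σ` and `x ∈ ℝ^σ`: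
`d! · (2π)^d · hermiteFun (∏_j X_{i j}) x = Σ_{S ⊆ [d]} (−1)^{d − #S} · (d∕dt)^d|_{t=0} bkerCore (t • 𝟙^i_S) x`, with the INTEGRAL direction
`𝟙^i_S k = #{j ∈ S | i j = k}` — every monomial × Gaussian (hence, by linearity, every polynomial × Gaussian vector) is an explicit finite combination of
`d`-th line derivatives at `0` of the shifted Gaussians `t ↦ bkerCore (t • 𝟙^i_S)` (§1 with `y_j = x_{i j}` + (L1)). [cite: Howe1989, §3] [cite: Folland1989, §1.6–§1.7] -/
theorem factorial_mul_hermiteFun_prod_X {d : ℕ} (i : Fin d → σ) (x : σ → ℝ) :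
    ((d.factorial : ℕ) : ℂ) * (2 * π : ℂ) ^ d * hermiteFun (∏ j, X (i j)) x =
      ∑ S : Finset (Fin d), (-1 : ℂ) ^ (d - #S) *
        iteratedDeriv d (fun t : ℂ => bkerCore (t • fun k => ((#(S.filter fun j => i j = k) : ℕ) : ℂ)) x) 0 := by
  have hpol := factorial_mul_prod_eq_sum_powerset_pow (R := ℂ) fun j => (x (i j) : ℂ)
  simp only [iteratedDeriv_bkerCore_smul_indicator_zero]
  rw [hermiteFun, map_prod]
  simp only [eval_X]
  calc ((d.factorial : ℕ) : ℂ) * (2 * π : ℂ) ^ d * ((∏ j, (x (i j) : ℂ)) * gauss x)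
      = (2 * π : ℂ) ^ d * gauss x * (((d.factorial : ℕ) : ℂ) * ∏ j, (x (i j) : ℂ)) := by ring
    _ = (2 * π : ℂ) ^ d * gauss x * ∑ S : Finset (Fin d), (-1 : ℂ) ^ (d - #S) * (∑ j ∈ S, (x (i j) : ℂ)) ^ d := by rw [hpol]
    _ = ∑ S : Finset (Fin d), (-1 : ℂ) ^ (d - #S) * ((2 * π : ℂ) ^ d * (∑ j ∈ S, (x (i j) : ℂ)) ^ d * gauss x) := by
      rw [Finset.mul_sum]
      exact Finset.sum_congr rfl fun S _ => by ring

/-- **the monomial × Gaussian vector itself** (divide by `d!·(2π)^d ≠ 0`):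
`hermiteFun (C c · ∏_j X_{i j}) x = c · (d!·(2π)^d)⁻¹ · Σ_S (−1)^{d−#S} · (d∕dt)^d|₀ bkerCore (t • 𝟙^i_S) x`. [cite: Howe1989, §3] [cite: Folland1989, §1.7] -/
theorem hermiteFun_C_mul_prod_X {d : ℕ} (c : ℂ) (i : Fin d → σ) (x : σ → ℝ) :
    hermiteFun (C c * ∏ j, X (i j)) x =
      c * ((((d.factorial : ℕ) : ℂ) * (2 * π : ℂ) ^ d)⁻¹ *
        ∑ S : Finset (Fin d), (-1 : ℂ) ^ (d - #S) *
          iteratedDeriv d (fun t : ℂ => bkerCore (t • fun k => ((#(S.filter fun j => i j = k) : ℕ) : ℂ)) x) 0) := by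
  have hne : ((d.factorial : ℕ) : ℂ) * (2 * π : ℂ) ^ d ≠ 0 :=
    mul_ne_zero (Nat.cast_ne_zero.2 (Nat.factorial_ne_zero d)) (pow_ne_zero _ (mul_ne_zero two_ne_zero (Complex.ofReal_ne_zero.2 Real.pi_ne_zero)))
  rw [← factorial_mul_hermiteFun_prod_X, ← mul_assoc (_⁻¹), inv_mul_cancel₀ hne, one_mul, hermiteFun, hermiteFun, map_mul, eval_C, mul_assoc]

/-- **Schwartz reading** of the table for the Weil files' vectors ★ `hermiteSchwartzPi`. [cite: Folland1989, §1.7] -/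
theorem hermiteSchwartzPi_C_mul_prod_X_apply {d : ℕ} (c : ℂ) (i : Fin d → σ) (x : σ → ℝ) :
    hermiteSchwartzPi (C c * ∏ j, X (i j)) x =
      c * ((((d.factorial : ℕ) : ℂ) * (2 * π : ℂ) ^ d)⁻¹ *
        ∑ S : Finset (Fin d), (-1 : ℂ) ^ (d - #S) *
          iteratedDeriv d (fun t : ℂ => bkerCore (t • fun k => ((#(S.filter fun j => i j = k) : ℕ) : ℂ)) x) 0) := by
  rw [hermiteSchwartzPi_apply, hermiteFun_C_mul_prod_X]

end Table

end Summit.HodgeConjecture.HodgeConjecture.Cruxes.HLiu418.K2LiuPolyGaussianShiftDerivatives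

end
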